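import Summits.SmoothPoincare4.SmoothPoincare4.Theorems.SullivanDualWitnessChargeV15CapModel
import Summits.SmoothPoincare4.SmoothPoincare4.Theorems.SullivanDualWitnessChargeV15MemberSphere
import Summits.SmoothPoincare4.SmoothPoincare4.Theorems.SullivanDualWitnessChargeV15SphereHomotopy
import Summits.SmoothPoincare4.SmoothPoincare4.Theorems.SullivanDualWitnessChargeV15InterceptChart
import Summits.SmoothPoincare4.SmoothPoincare4.Theorems.SullivanDualWitnessChargeV15LeafFloc
import Summits.SmoothPoincare4.SmoothPoincare4.Theorems.SullivanDualWitnessChargeSubstubFar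
import Summits.SmoothPoincare4.SmoothPoincare4.Theorems.SullivanDualWitnessChargeFlatChart
import Summits.SmoothPoincare4.SmoothPoincare4.Theorems.SullivanDualWitnessChargeLocalFamilyUniv
import Summits.SmoothPoincare4.SmoothPoincare4.Theorems.SymplecticOrigamiGromovRecognitionRelEndGluedBasics
import Summits.SmoothPoincare4.SmoothPoincare4.Theorems.SullivanDualWitnessChargeReductionV7
import Summits.SmoothPoincare4.SmoothPoincare4.Theorems.SullivanDualWitnessChargeLimitEmbedded
import Literature.Geometry.Symplectic.JSphereLocalFoliation
import Literature.Geometry.Symplectic.JHolomorphicLimitEmbeddedProofs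
import Literature.Geometry.Symplectic.JHolomorphicIsolatedIntersectionPersists
import Literature.Geometry.Symplectic.JHolomorphicRepresentationFormula

/-!
# Crux `WitnessCharge`, skeleton v18: A′ from the HLS foliation and the J-DECORATED normal-witness transfer (lead c9)

`helper_localFamilyUniv_of_hls_nwtJ` — the deep stub A′ (= `substub_localFamilyUniv` of the line
`Sketch`: the local family of Gromov's pencil of `J`-planes at a member, WITH universality, for a
homotopy 4-sphere with standard end) from

* `Literature.Geometry.Symplectic.hls_localFoliation_embeddedSphere_trivialNormal` (crux 16778) and
* the **`J`-decorated normal-witness transfer** `C2J` (second hypothesis, spelled out): in an almost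
  complex 4-manifold, if `S = (u₀, v₀)` and `C = (u, v)` are EMBEDDED `JX`-holomorphic two-chart
  spheres with homotopic glued maps and `S` is cut out by a submersion `π` on an open `N ⊇ S`, then
  `C` is cut out by a submersion `π'` on an open `N' ⊇ C`. `C2J` is implied trivially by the route
  item `NormalWitnessTransfer` (stmt-SmoothPoincare4-18059, the same statement WITHOUT the four
  `J`-holomorphy hypotheses) and by the crux `AdjunctionEmbeddedSpheres` (stmt-16775, which moreover
  only asks `C` somewhere injective) — see `SullivanDualWitnessChargeReductionV18.lean`,

and the LANDED parts of skeleton v15 (`stub_capModel`, `stub_memberSphere`, `stub_sphereHomotopy`,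
`stub_interceptChart`, `stub_leafFloc`). This is `helper_localFamilyUniv_of_facts`
(`…V16AssemblyFacts.lean`, p153628) with its single use of adjunction replaced by `C2J`: the member
sphere is already known to be embedded (`stub_memberSphere`), so only the witness transfer is used.
-/

noncomputable section

set_option linter.dupNamespace false

open scoped Manifold ContDiff Topology
open Set Filter Function Literature.Geometry.Symplectic Literature.Topology.FourManifolds
  Literature.Topology.FourManifolds.ComplexProjectiveSpace
  Summit.SmoothPoincare4.SmoothPoincare4.Theorems.GromovRecognitionRelEnd.CrossCapLaurent

namespace Summit.SmoothPoincare4.SmoothPoincare4.Theorems.WitnessCharge.PencilIncompleteness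

/-- **A′ from the HLS local foliation and the `J`-decorated normal-witness transfer `C2J`** (see the
module docstring). -/
theorem helper_localFamilyUniv_of_hls_nwtJ :
    Literature.Geometry.Symplectic.hls_localFoliation_embeddedSphere_trivialNormal →
    (∀ (X : Type) [TopologicalSpace X] [T2Space X] [SecondCountableTopology X]
      [ChartedSpace (EuclideanSpace ℝ (Fin 4)) X] [IsManifold (𝓡 4) ∞ X]
      (JX : AlmostComplexStructure (𝓡 4) ∞ X) (u₀ v₀ : ℂ → X) (N : Set X) (π : X → ℂ)
      (u v : ℂ → X) (F F₀ : C(ComplexProjectiveSpace 1, X)),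
      ContMDiff 𝓘(ℝ, ℂ) (𝓡 4) ∞ u₀ → ContMDiff 𝓘(ℝ, ℂ) (𝓡 4) ∞ v₀ → (∀ z : ℂ, z ≠ 0 → v₀ z = u₀ z⁻¹) →
      IsJHolomorphic (𝓡 4) (fun y => JX y) u₀ → IsJHolomorphic (𝓡 4) (fun y => JX y) v₀ →
      Injective u₀ → (∀ z, Injective (mfderiv 𝓘(ℝ, ℂ) (𝓡 4) u₀ z)) →
      Injective (mfderiv 𝓘(ℝ, ℂ) (𝓡 4) v₀ 0) → v₀ 0 ∉ range u₀ →
      IsOpen N → range u₀ ∪ {v₀ 0} ⊆ N → ContMDiffOn (𝓡 4) 𝓘(ℝ, ℂ) ∞ π N →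
      (∀ y ∈ N, Surjective (mfderiv (𝓡 4) 𝓘(ℝ, ℂ) π y)) →
      {y | y ∈ N ∧ π y = 0} = range u₀ ∪ {v₀ 0} →
      ContMDiff 𝓘(ℝ, ℂ) (𝓡 4) ∞ u → ContMDiff 𝓘(ℝ, ℂ) (𝓡 4) ∞ v → (∀ z : ℂ, z ≠ 0 → v z = u z⁻¹) →
      IsJHolomorphic (𝓡 4) (fun y => JX y) u → IsJHolomorphic (𝓡 4) (fun y => JX y) v →
      Injective u → (∀ z, Injective (mfderiv 𝓘(ℝ, ℂ) (𝓡 4) u z)) →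
      Injective (mfderiv 𝓘(ℝ, ℂ) (𝓡 4) v 0) → v 0 ∉ range u →
      (∀ p, CoordNeZero 0 p → F p = u (affineCoordComplex 0 p 0)) →
      (∀ p, CoordNeZero 1 p → F p = v (affineCoordComplex 1 p 0)) →
      (∀ p, CoordNeZero 0 p → F₀ p = u₀ (affineCoordComplex 0 p 0)) →
      (∀ p, CoordNeZero 1 p → F₀ p = v₀ (affineCoordComplex 1 p 0)) →
      F.Homotopic F₀ →
      ∃ (N' : Set X) (π' : X → ℂ), IsOpen N' ∧ range u ∪ {v 0} ⊆ N' ∧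
        ContMDiffOn (𝓡 4) 𝓘(ℝ, ℂ) ∞ π' N' ∧ (∀ y ∈ N', Surjective (mfderiv (𝓡 4) 𝓘(ℝ, ℂ) π' y)) ∧
        {y | y ∈ N' ∧ π' y = 0} = range u ∪ {v 0}) →
    ∀ (S : HomotopySphere 4) (p : S.carrier)
      (J : ∀ x : punctured p, TangentSpace (𝓡 4) x →L[ℝ] TangentSpace (𝓡 4) x) (ε' : ℝ),
      0 < ε' →
      Metric.closedBall (extChartAt (𝓡 4) p p) ε' ⊆ (extChartAt (𝓡 4) p).target →
      (∀ (x : punctured p) (v : TangentSpace (𝓡 4) x), J x (J x v) = -v) →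
      (∀ x₀ : punctured p, ContMDiffAt (𝓡 4) 𝓘(ℝ, EuclideanSpace ℝ (Fin 4) →L[ℝ] EuclideanSpace ℝ (Fin 4)) ∞
        (inTangentCoordinates (𝓡 4) (𝓡 4) (id : punctured p → punctured p) id (fun x => J x) x₀) x₀) →
      (∀ x : punctured p, InPuncturedChartBall p ε' x →
        ∀ (v : TangentSpace (𝓡 4) x) (b : EuclideanSpace ℝ (Fin 4)),
          inner ℝ (fderiv ℝ inversion (extChartAt (𝓡 4) p x.1 - extChartAt (𝓡 4) p p)
            (mfderiv (𝓡 4) 𝓘(ℝ, EuclideanSpace ℝ (Fin 4))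
              (fun z : punctured p => extChartAt (𝓡 4) p z.1) x (J x v))) b
          = stdSymplecticForm (fderiv ℝ inversion (extChartAt (𝓡 4) p x.1 - extChartAt (𝓡 4) p p)
            (mfderiv (𝓡 4) 𝓘(ℝ, EuclideanSpace ℝ (Fin 4))
              (fun z : punctured p => extChartAt (𝓡 4) p z.1) x v)) b) →
      ∀ (u₀ : ℂ → punctured p) (b₀ : ℂ), IsPencilMember J u₀ b₀ →
        ∃ δ : ℝ, 0 < δ ∧ ∃ Floc : ℂ → ℂ → punctured p, Floc b₀ = u₀ ∧
          (∀ b ∈ Metric.ball b₀ δ, IsPencilMember J (Floc b) b) ∧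
          ContMDiffOn 𝓘(ℝ, ℂ × ℂ) (𝓡 4) ∞ (fun q : ℂ × ℂ => Floc q.1 q.2)
            ((Metric.ball b₀ δ) ×ˢ (univ : Set ℂ)) ∧
          (∀ q : ℂ × ℂ, q.1 ∈ Metric.ball b₀ δ →
            Function.Injective (mfderiv 𝓘(ℝ, ℂ × ℂ) (𝓡 4) (fun q : ℂ × ℂ => Floc q.1 q.2) q)) ∧
          ∃ (r₀ : ℝ) (V : Set (ℂ × punctured p)), IsOpen V ∧ (∀ ξ : ℂ, (ξ, u₀ ξ) ∈ V) ∧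
            ∀ (u : ℂ → punctured p) (b : ℂ), IsPencilMember J u b → b ∈ Metric.ball b₀ δ →
              (∀ ξ : ℂ, ‖ξ‖ ≤ r₀ → (ξ, u ξ) ∈ V) → u = Floc b := by
  intro hls hnwt S p J ε' hε' hball hJ2 hJsm hJstd u₀ b₀ hu₀
  -- S2: the cap model
  obtain ⟨D⟩ := stub_capModel S p J ε' hε' hball hJ2 hJsm hJstd
  -- S3: compactified member, far sphere, far witness
  obtain ⟨hscale, hsph, hfar⟩ := stub_memberSphere S p J ε' hε' hball hJ2 hJsm hJstd D
  obtain ⟨lam, hlam⟩ := hscale u₀ b₀ hu₀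
  have hlam0 : (lam : ℂ) ≠ 0 := by
    have : (4 : ℝ) ≤ lam := hlam.1
    exact_mod_cast (show lam ≠ 0 by linarith)
  obtain ⟨hU0s, hV0s, hUV0, hJU0, hJV0, hU0inj, hU0imm, hV0imm, hV0notin⟩ :=
    hsph u₀ b₀ lam hu₀ hlam
  set bf : ℂ := ((ε'⁻¹ + 1 : ℝ) : ℂ) with hbf_def
  have hbf : ε'⁻¹ < ‖bf‖ := inv_lt_norm_far hε'
  have hfarMem : IsPencilMember J (farLine hε' hball hbf) bf := isPencilMember_farLine hε' hball hbf J hJstd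
  obtain ⟨lamf, hlamf⟩ := hscale (farLine hε' hball hbf) bf hfarMem
  obtain ⟨hUfs, hVfs, hUVf, hJUf, hJVf, hUfinj, hUfimm, hVfimm, hVfnotin⟩ :=
    hsph (farLine hε' hball hbf) bf lamf hfarMem hlamf
  obtain ⟨N, π, hNopen, hNsub, hπs, hπsurj, hzero⟩ := hfar bf hbf lamf hlamf
  -- glued maps of the two spheres
  obtain ⟨F0, hF0u, hF0v⟩ := helper_gluedExists D.X (D.sphereU u₀ lam) (D.sphereV u₀ b₀ lam)
    hU0s.continuous hV0s.continuous hUV0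
  obtain ⟨Ff, hFfu, hFfv⟩ := helper_gluedExists D.X (D.sphereU (farLine hε' hball hbf) lamf)
    (D.sphereV (farLine hε' hball hbf) bf lamf) hUfs.continuous hVfs.continuous hUVf
  -- S4: the member sphere is homotopic to the far sphere
  have hhom0 : F0.Homotopic Ff := stub_sphereHomotopy S p J ε' hε' hball hJ2 hJsm hJstd D u₀ b₀ lam hu₀ hlam hU0s hV0s
    bf hbf lamf hlamf hUfs hVfs F0 Ff hF0u hF0v hFfu hFfv
  -- C2J: the (embedded, `JX`-holomorphic) member sphere inherits a trivial-normal-bundle witness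
  obtain ⟨N', π', hN'open, hN'sub, hπ's, hπ'surj, hzero'⟩ := hnwt D.X D.JX
    (D.sphereU (farLine hε' hball hbf) lamf) (D.sphereV (farLine hε' hball hbf) bf lamf) N π
    (D.sphereU u₀ lam) (D.sphereV u₀ b₀ lam) F0 Ff
    hUfs hVfs hUVf hJUf hJVf hUfinj hUfimm hVfimm hVfnotin hNopen hNsub hπs hπsurj hzero
    hU0s hV0s hUV0 hJU0 hJV0 hU0inj hU0imm hV0imm hV0notin hF0u hF0v hFfu hFfv hhom0
  -- HLS: the local family of embedded `JX`-spheres through the member sphere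
  obtain ⟨ε, U, V, hε, hU0eq, hV0eq, hleaf, hUs, hVs, hdisj, himm, hsweep, huniq⟩ := hls D.X D.JX
    (D.sphereU u₀ lam) (D.sphereV u₀ b₀ lam) N' π'
    hU0s hV0s hUV0 hJU0 hJV0 hU0inj hU0imm hV0imm hV0notin hN'open hN'sub hπ's hπ'surj hzero'
  -- S5: the intercept chart
  obtain ⟨ε₁, r₁, δ, wz, α, β, hε₁, hε₁le, hr₁, hr₁le, hδ, hwzs, hwz0, hwzlt, hVcap, hhit, hUin,
    hholo, hderiv, hVwz, hβeq, hβs, hβ0, hαs, hα0, hαβ, hβα, hαbij⟩ :=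
    stub_interceptChart S p J ε' hε' hball hJ2 hJsm hJstd D u₀ b₀ lam hu₀ hlam ε U V hε hU0eq hV0eq
      (fun a ha => ⟨(hleaf a ha).2.2.1, (hleaf a ha).2.2.2.1, (hleaf a ha).2.2.2.2.1⟩) hUs hVs himm
  -- S6: the family of members read off the leaves
  obtain ⟨δ', Floc, hδ', hδ'le, hFloc0, hmem, hsmooth, hinjd, hrange⟩ :=
    stub_leafFloc S p J ε' hε' hball hJ2 hJsm hJstd D u₀ b₀ lam hu₀ hlam ε U V hε hU0eq hV0eq hleaf hUs hVs himm
      ε₁ r₁ δ wz α β hε₁ hε₁le hr₁ hr₁le hδ hwzs hwz0 hwzlt hVcap hhit hUin hholo hderiv hVwz hβeq hβs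
      hβ0 hαs hα0 hαβ hβα hαbij
  -- the sweep and the neighbourhood `V`
  set sweep : Set D.X := ⋃ a ∈ Metric.ball (0 : ℂ) ε, (range (U a) ∪ {V a 0}) with hsweep_def
  refine ⟨δ', hδ', Floc, hFloc0, hmem, hsmooth, hinjd, 0, (univ : Set ℂ) ×ˢ (D.ι ⁻¹' sweep),
    isOpen_univ.prod (hsweep.preimage D.contMDiff_ι.continuous), fun ξ => ?_, ?_⟩
  · -- the graph of `u₀` lies in `V`: `ι (u₀ ξ) = U 0 (ξ / lam)`
    refine ⟨mem_univ _, ?_⟩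
    show D.ι (u₀ ξ) ∈ sweep
    rw [hsweep_def, mem_iUnion₂]
    refine ⟨0, by simpa using hε, Or.inl ⟨ξ / lam, ?_⟩⟩
    rw [hU0eq, CapData.sphereU_apply, mul_div_cancel₀ _ hlam0]
  · -- UNIVERSALITY
    intro u b hu hb hVmem
    have h0 : D.ι (u 0) ∈ sweep := (hVmem 0 (by simp)).2
    rw [hsweep_def, mem_iUnion₂] at h0
    obtain ⟨a₁, ha₁, hmeet⟩ := h0
    rw [Metric.mem_ball, dist_zero_right] at ha₁
    -- the compactified `u`
    obtain ⟨lam', hlam'⟩ := hscale u b hu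
    have hlam'0 : (lam' : ℂ) ≠ 0 := by
      have : (4 : ℝ) ≤ lam' := hlam'.1
      exact_mod_cast (show lam' ≠ 0 by linarith)
    obtain ⟨hUs', hVs', hUV', hJU', hJV', -, -, -, -⟩ := hsph u b lam' hu hlam'
    obtain ⟨Fu, hFuu, hFuv⟩ := helper_gluedExists D.X (D.sphereU u lam') (D.sphereV u b lam')
      hUs'.continuous hVs'.continuous hUV'
    have hhomu : Fu.Homotopic Ff := stub_sphereHomotopy S p J ε' hε' hball hJ2 hJsm hJstd D u b lam' hu hlam' hUs' hVs'
      bf hbf lamf hlamf hUfs hVfs Fu Ff hFuu hFuv hFfu hFfv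
    have hhom : Fu.Homotopic F0 := hhomu.trans hhom0.symm
    -- HLS uniqueness: the image of the compactified `u` is a leaf `a₂`
    obtain ⟨a₂, ha₂, himage⟩ := huniq (D.sphereU u lam') (D.sphereV u b lam') Fu F0 hUs' hVs' hUV'
      hJU' hJV' hFuu hFuv hF0u hF0v hhom
      ⟨0, a₁, ha₁, by simpa [CapData.sphereU_apply] using hmeet⟩
    -- the leaf `α b` contains `capPt b`
    have hbδ : b ∈ Metric.ball b₀ δ := Metric.ball_subset_ball hδ'le hb
    obtain ⟨hαb, hβαb⟩ := hαβ b hbδ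
    have hαbε : ‖α b‖ < ε := by
      rw [Metric.mem_ball, dist_zero_right] at hαb
      exact hαb.trans_le hε₁le
    have hcap_b : D.capPt b ∈ range (U (α b)) ∪ {V (α b) 0} := by
      have h1 : V (α b) (wz (α b)) = D.capPt b := by rw [hVwz (α b) hαb, hβαb]
      by_cases hw : wz (α b) = 0
      · right
        rw [mem_singleton_iff, ← h1, hw]
      · left
        exact ⟨(wz (α b))⁻¹, by rw [← (hleaf (α b) hαbε).2.2.1 (wz (α b)) hw, h1]⟩
    -- the leaf `a₂` contains `capPt b = sphereV u b lam' 0`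
    have hcap_b2 : D.capPt b ∈ range (U a₂) ∪ {V a₂ 0} := by
      rw [← himage]
      right
      rw [mem_singleton_iff, CapData.sphereV_zero]
    -- distinct leaves are disjoint, so `a₂ = α b`
    have ha₂a : a₂ = α b := by
      by_contra hne
      exact Set.disjoint_left.1 (hdisj a₂ (α b) ha₂ hαbε hne) hcap_b2 hcap_b
    -- compare ranges: `ι(u(ℂ)) = leaf ∩ ι(Σ ∖ p) = ι(Floc b (ℂ))`
    have hr1 : range (D.ι ∘ u) = (range (U (α b)) ∪ {V (α b) 0}) ∩ range D.ι := by
      rw [← ha₂a, ← himage]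
      apply Subset.antisymm
      · rintro _ ⟨ξ, rfl⟩
        refine ⟨Or.inl ⟨ξ / lam', ?_⟩, ⟨u ξ, rfl⟩⟩
        rw [CapData.sphereU_apply, mul_div_cancel₀ _ hlam'0, comp_apply]
      · rintro y ⟨hy, ⟨x, rfl⟩⟩
        rcases hy with ⟨ζ, hζ⟩ | hy
        · refine ⟨(lam' : ℂ) * ζ, ?_⟩
          rw [comp_apply, ← CapData.sphereU_apply]
          exact hζ
        · exfalso
          rw [mem_singleton_iff, CapData.sphereV_zero] at hy
          exact D.ι_ne_capPt x b hy
    have hrr : range u = range (Floc b) := by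
      have h : range (D.ι ∘ u) = range (D.ι ∘ Floc b) := by rw [hr1, hrange b hb]
      rw [range_comp, range_comp] at h
      exact (image_injective.2 D.isOpenEmbedding_ι.injective) h
    exact IsPencilPlane.eq_of_range_eq (isPencilMember_iff_isPencilPlane.1 hu)
      (isPencilMember_iff_isPencilPlane.1 (hmem b hb)) hrr



/-- **The crux `WitnessCharge` from the HLS local foliation and `C2J` (registered helper
`helper_witnessCharge_of_hls_nwtJ`).** McDuff's no-cusp theorem F5 is DISCHARGED
(`jHolomorphic_immersed_of_limitEmbedded_punctured_holds`), so ReductionV7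
`WitnessCharge_of_localFamilyUniv_of_limitEmbedded : A′ → D1b → WitnessCharge` applies to A′ (above)
and D1b (`substub_limitEmbedded_of_mcduff` on
`jHolomorphicLimitOfEmbedded_isEmbedded_of_persist_of_noCusp persists F5`). -/
theorem helper_witnessCharge_of_hls_nwtJ :
    Literature.Geometry.Symplectic.hls_localFoliation_embeddedSphere_trivialNormal →
    (∀ (X : Type) [TopologicalSpace X] [T2Space X] [SecondCountableTopology X]
      [ChartedSpace (EuclideanSpace ℝ (Fin 4)) X] [IsManifold (𝓡 4) ∞ X]
      (JX : AlmostComplexStructure (𝓡 4) ∞ X) (u₀ v₀ : ℂ → X) (N : Set X) (π : X → ℂ)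
      (u v : ℂ → X) (F F₀ : C(ComplexProjectiveSpace 1, X)),
      ContMDiff 𝓘(ℝ, ℂ) (𝓡 4) ∞ u₀ → ContMDiff 𝓘(ℝ, ℂ) (𝓡 4) ∞ v₀ → (∀ z : ℂ, z ≠ 0 → v₀ z = u₀ z⁻¹) →
      IsJHolomorphic (𝓡 4) (fun y => JX y) u₀ → IsJHolomorphic (𝓡 4) (fun y => JX y) v₀ →
      Injective u₀ → (∀ z, Injective (mfderiv 𝓘(ℝ, ℂ) (𝓡 4) u₀ z)) →
      Injective (mfderiv 𝓘(ℝ, ℂ) (𝓡 4) v₀ 0) → v₀ 0 ∉ range u₀ →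
      IsOpen N → range u₀ ∪ {v₀ 0} ⊆ N → ContMDiffOn (𝓡 4) 𝓘(ℝ, ℂ) ∞ π N →
      (∀ y ∈ N, Surjective (mfderiv (𝓡 4) 𝓘(ℝ, ℂ) π y)) →
      {y | y ∈ N ∧ π y = 0} = range u₀ ∪ {v₀ 0} →
      ContMDiff 𝓘(ℝ, ℂ) (𝓡 4) ∞ u → ContMDiff 𝓘(ℝ, ℂ) (𝓡 4) ∞ v → (∀ z : ℂ, z ≠ 0 → v z = u z⁻¹) →
      IsJHolomorphic (𝓡 4) (fun y => JX y) u → IsJHolomorphic (𝓡 4) (fun y => JX y) v →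
      Injective u → (∀ z, Injective (mfderiv 𝓘(ℝ, ℂ) (𝓡 4) u z)) →
      Injective (mfderiv 𝓘(ℝ, ℂ) (𝓡 4) v 0) → v 0 ∉ range u →
      (∀ p, CoordNeZero 0 p → F p = u (affineCoordComplex 0 p 0)) →
      (∀ p, CoordNeZero 1 p → F p = v (affineCoordComplex 1 p 0)) →
      (∀ p, CoordNeZero 0 p → F₀ p = u₀ (affineCoordComplex 0 p 0)) →
      (∀ p, CoordNeZero 1 p → F₀ p = v₀ (affineCoordComplex 1 p 0)) →
      F.Homotopic F₀ →
      ∃ (N' : Set X) (π' : X → ℂ), IsOpen N' ∧ range u ∪ {v 0} ⊆ N' ∧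
        ContMDiffOn (𝓡 4) 𝓘(ℝ, ℂ) ∞ π' N' ∧ (∀ y ∈ N', Surjective (mfderiv (𝓡 4) 𝓘(ℝ, ℂ) π' y)) ∧
        {y | y ∈ N' ∧ π' y = 0} = range u ∪ {v 0}) →
    Summit.SmoothPoincare4.SmoothPoincare4.Theses.SullivanDual.WitnessCharge :=
  fun hls hnwt =>
    WitnessCharge_of_localFamilyUniv_of_limitEmbedded (helper_localFamilyUniv_of_hls_nwtJ hls hnwt)
      (substub_limitEmbedded_of_mcduff
        (Literature.Geometry.Symplectic.jHolomorphicLimitOfEmbedded_isEmbedded_of_persist_of_noCusp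
          Literature.Geometry.Symplectic.jHolomorphic_isolatedIntersection_persists_holds
          Literature.Geometry.Symplectic.jHolomorphic_immersed_of_limitEmbedded_punctured_holds))

end Summit.SmoothPoincare4.SmoothPoincare4.Theorems.WitnessCharge.PencilIncompleteness
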